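import Literature.Topology.FourManifolds.CouplePsi

/-!
# The structure conjugacy of a couple: cone correction at the minimum and the extension
# `pull_B ∘ Ψ₁ ∘ push_A`

Topic `Literature/Topology/FourManifolds` (ninth file of the *structure conjugacy* of two
one-level Morse data on a handlebody, support of `stmt-SmoothPoincare4-15190`; the two-function
analogue of `PairPreExtExtension.lean` / `PairEndgame.lean`).  Everything here is **proved**.

For a couple `C` with saddle data `Q`, level map `M`, an admissible direction map `T` with
widths `δ, ρ` (`CouplePsi.lean`) and a map `Θ` of the model space which preserves the norm and
**is the cone of `T` on the shell `rad/2 ≤ ‖v‖ ≤ rad`**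
(`Θ v = (‖v‖/rad) • T ((rad/‖v‖) • v)`; in dimension `3` such a diffeomorphism exists for the
cone of every diffeomorphism of `S²`, `ConeRadialExtension.lean`):

* `SaddleData.psi₁` — `ofChart_B ∘ Θ ∘ toChart_A` inside `{g_A < sphR}`, the glued map `psi0`
  outside; the two agree on the shell (`ofChart_Θ_toChart_eq_psi0`), so `psi₁` has level
  `lam ∘ g_A` below `hi` (`apply_psi₁`), is inverted by the corrected map of the swapped data
  (`psi₁_psi₁`) and is **smooth at every point of `{g_A < hi}`** (`contMDiffAt_psi₁`);
* `SaddleData.ext = pull_B ∘ psi₁ ∘ push_A`, `SaddleData.bdryMap = bret_B ∘ psi₁ ∘ push_A ∘ incl`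
  — the extension and **the induced boundary map**, with `ext ∘ incl = incl ∘ bdryMap`
  (`ext_coe`); `SaddleData.extDiffeomorph`, `SaddleData.bdryDiffeomorph` for mutually inverse
  data, and **`bdryDiffeomorph` extends over `W`** (`diffeoExtends_bdryDiffeomorph`).

## References

* J. Milnor, *Lectures on the h-cobordism theorem* (1965), Def. 3.1, proof of Thm. 3.4, Def. 3.9,
  Thm. 4.1 (PDF pp. 11–13, 16, 22). [MilnorHCobordism1965]
* J. Cerf, *Sur les difféomorphismes de la sphère de dimension trois (Γ₄ = 0)*, LNM 53 (1968),
  Ch. I §1, Lemme 2. [CerfDiffeoSphere1968]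
-/

open scoped Manifold ContDiff Topology
open Set Function Filter Metric

noncomputable section

namespace Literature.Topology.FourManifolds

open Cobordism FourManifolds.Flow

universe u

variable {n : ℕ} {W : Type u} [TopologicalSpace W] [T2Space W] [SecondCountableTopology W]
  [CompactSpace W] [ChartedSpace (EuclideanHalfSpace (n + 1)) W] [IsManifold (𝓡∂ (n + 1)) ∞ W]

namespace BasinCouple

variable {gA gB : W → ℝ} {ξA ξB : Π x : W, TangentSpace (𝓡∂ (n + 1)) x} {C : BasinCouple gA gB ξA ξB}

namespace SaddleData

variable (Q : C.SaddleData) (M : Q.LevelMap)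

/-! ### The identity level map -/

/-- **When the two data have the same minimum value and the same saddle value, the identity is a
level map.** (The general case is reduced to this one by Milnor's rearrangement of the critical
values of `g_B`, Thm. 4.1, which keeps `ξ_B` and hence the traces.) [cite: MilnorHCobordism1965, Thm. 4.1 (PDF p. 22)] -/
def LevelMap.ofEq (h₀ : gB C.B.p₀ = gA C.A.p₀) (hc : Q.QB.c = Q.QA.c) : Q.LevelMap where
  lam := id
  lam' := id
  contDiff_lam := contDiff_id
  contDiff_lam' := contDiff_id
  strictMono_lam := strictMono_id
  strictMono_lam' := strictMono_id
  lam'_lam _ := rfl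
  lam_lam' _ := rfl
  lam_of_le_sph ℓ _ := by simp only [id_eq, h₀, sub_self, add_zero]
  lam_of_abs_le ℓ _ := by simp only [id_eq, hc, sub_self, add_zero]
  lam_of_L_le _ _ := rfl

/-- The identity level map is the identity. [folklore] -/
@[simp] theorem LevelMap.ofEq_lam (h₀ : gB C.B.p₀ = gA C.A.p₀) (hc : Q.QB.c = Q.QA.c) : (LevelMap.ofEq Q h₀ hc).lam = id := rfl

/-! ### The corrected map near the minimum -/

open scoped Classical in
/-- **The corrected map `Ψ₁`**: inside the ball `{g_A < sphR}` the chart conjugate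
`ofChart_B ∘ Θ ∘ toChart_A`, outside it the glued map `psi0`. [cite: MilnorHCobordism1965, Thm. 4.1] [cite: CerfDiffeoSphere1968, Ch. I §1, Lemme 2] -/
def psi₁ (T Θ : EuclideanSpace ℝ (Fin (n + 1)) → EuclideanSpace ℝ (Fin (n + 1))) (δ ρ : ℝ) (x : W) : W :=
  if gA x < C.A.sphR then C.B.ofChart (Θ (C.A.toChart x)) else Q.psi0 M T δ ρ x

variable {Q M}
variable {T T' Θ Θ' : EuclideanSpace ℝ (Fin (n + 1)) → EuclideanSpace ℝ (Fin (n + 1))} {δ ρ : ℝ}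

/-- `psi₁` inside the ball. [folklore] -/
theorem psi₁_of_lt {x : W} (hx : gA x < C.A.sphR) : Q.psi₁ M T Θ δ ρ x = C.B.ofChart (Θ (C.A.toChart x)) := by
  unfold psi₁; rw [if_pos hx]

/-- `psi₁` outside the ball. [folklore] -/
theorem psi₁_of_le {x : W} (hx : C.A.sphR ≤ gA x) : Q.psi₁ M T Θ δ ρ x = Q.psi0 M T δ ρ x := by
  unfold psi₁; rw [if_neg (not_lt.2 hx)]

/-- `g_A p₀ < sphR'`. [folklore] -/
theorem apply_p₀_lt_sphR' (B : BasinSetting gA ξA) : gA B.p₀ < B.sphR' := by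
  unfold BasinSetting.sphR'; have := B.rad_pos; nlinarith

/-- Points with `sphR ≤ g_A x < hi` have level in `(g_A p₀, hi)`. [folklore] -/
theorem mem_Ioo_of_sphR_le {x : W} (hx : C.A.sphR ≤ gA x) (hx' : gA x < C.A.hi) : gA x ∈ Ioo (gA C.A.p₀) C.A.hi :=
  ⟨(apply_p₀_lt_sphR' C.A).trans (C.A.sphR'_lt_sphR.trans_le hx), hx'⟩

section Cone

-- `Θ` preserves the norm ...
variable (hΘn : ∀ v, ‖Θ v‖ = ‖v‖)
-- ... and is the cone of `T` on the shell `rad / 2 ≤ ‖v‖ ≤ rad`.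
variable (hΘc : ∀ v : EuclideanSpace ℝ (Fin (n + 1)), C.A.rad / 2 ≤ ‖v‖ → ‖v‖ ≤ C.A.rad →
    Θ v = (‖v‖ / C.A.rad) • T ((C.A.rad / ‖v‖) • v))

include hΘn in
/-- **`psi₁` has level `lam ∘ g_A` below `hi`.** [folklore] -/
theorem apply_psi₁ (hA : Q.Adm M T δ ρ) {x : W} (hx : gA x < C.A.hi) : gB (Q.psi₁ M T Θ δ ρ x) = M.lam (gA x) := by
  by_cases hx' : gA x < C.A.sphR
  · have hxs : gA x ≤ C.A.sph := (hx'.trans C.A.sphR_lt_sph).le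
    have hv : ‖C.A.toChart x‖ ≤ C.A.r₀ := C.A.norm_toChart_le hxs
    rw [psi₁_of_lt hx', C.B.apply_ofChart (by rw [hΘn, C.r₀_eq]; exact hv), hΘn, C.A.norm_toChart_sq hxs,
      M.lam_of_le_sph _ hxs]; ring
  · rw [psi₁_of_le (not_lt.1 hx'), apply_psi0 hA (mem_Ioo_of_sphR_le (not_lt.1 hx') hx)]

include hΘc in
/-- **On the shell the chart conjugate of `Θ` is `psi0`**: for `g_A x ≤ sph` and
`rad/2 ≤ ‖toChart_A x‖ ≤ rad`, `ofChart_B (Θ (toChart_A x)) = psi0 x`. [cite: MilnorHCobordism1965, Def. 3.1 (2)] -/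
theorem ofChart_Θ_toChart_eq_psi0 (hA : Q.Adm M T δ ρ) {x : W} (hx : gA x ≤ C.A.sph) (h1 : C.A.rad / 2 ≤ ‖C.A.toChart x‖)
    (h2 : ‖C.A.toChart x‖ ≤ C.A.rad) : C.B.ofChart (Θ (C.A.toChart x)) = Q.psi0 M T δ ρ x := by
  set v := C.A.toChart x with hv
  have hv0 : v ≠ 0 := fun h => by rw [h, norm_zero] at h1; linarith [C.A.rad_pos]
  have hvr : ‖v‖ < C.A.r₀ := h2.trans_lt C.A.rad_lt_r₀
  have hxv : C.A.ofChart v = x := C.A.ofChart_toChart_of_apply_le hx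
  rw [hΘc v h1 h2, ← hxv, psi0_ofChart hA hv0 hvr]

include hΘc in
/-- **`psi₁ = psi0` off the inner ball** `{g_A < sphR'}`. [folklore] -/
theorem psi₁_eq_psi0_of_le (hA : Q.Adm M T δ ρ) {x : W} (hx : C.A.sphR' ≤ gA x) : Q.psi₁ M T Θ δ ρ x = Q.psi0 M T δ ρ x := by
  by_cases hx' : gA x < C.A.sphR
  · rw [psi₁_of_lt hx']
    have hxs : gA x ≤ C.A.sph := (hx'.trans C.A.sphR_lt_sph).le
    refine ofChart_Θ_toChart_eq_psi0 hΘc hA hxs ?_ ?_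
    · have h := (C.A.apply_lt_iff_norm_toChart_lt hxs (by linarith [C.A.rad_pos] : (0 : ℝ) ≤ C.A.rad / 2)).not.1
        (by unfold BasinSetting.sphR' at hx; exact not_lt.2 hx)
      exact not_lt.1 h
    · exact ((C.A.apply_lt_iff_norm_toChart_lt hxs C.A.rad_pos.le).1 hx').le
  · exact psi₁_of_le (not_lt.1 hx')

include hΘn in
/-- **The corrected map of the swapped data (inverse level map, left inverses `T'` of `T` on the
small sphere and `Θ'` of `Θ`) inverts the corrected map** below `hi`. [folklore] -/
theorem psi₁_psi₁ (hA : Q.Adm M T δ ρ) (hA' : Q.swap.Adm M.swap T' δ ρ) (hT'T : ∀ v, ‖v‖ = C.A.rad → T' (T v) = v)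
    (hΘ : LeftInverse Θ' Θ) {x : W} (hx : gA x < C.A.hi) : Q.swap.psi₁ M.swap T' Θ' δ ρ (Q.psi₁ M T Θ δ ρ x) = x := by
  have hlev := apply_psi₁ hΘn hA hx
  have hiff : gB (Q.psi₁ M T Θ δ ρ x) < C.B.sphR ↔ gA x < C.A.sphR := by
    rw [hlev, ← M.lam_sphR]; exact M.strictMono_lam.lt_iff_lt
  by_cases hx' : gA x < C.A.sphR
  · have hxs : gA x ≤ C.A.sph := (hx'.trans C.A.sphR_lt_sph).le
    rw [psi₁_of_lt (hiff.2 hx'), psi₁_of_lt hx', swap_A, swap_B,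
      C.B.toChart_ofChart (by rw [hΘn, C.r₀_eq]; exact C.A.norm_toChart_le hxs), hΘ, C.A.ofChart_toChart_of_apply_le hxs]
  · rw [psi₁_of_le (not_lt.1 fun h => hx' (hiff.1 h)), psi₁_of_le (not_lt.1 hx'),
      psi0_swap_psi0 hA hA' hT'T (mem_Ioo_of_sphR_le (not_lt.1 hx') hx)]

include hΘc in
/-- **`psi₁` is smooth at every point of `{g_A < hi}`**, for `Θ` smooth and norm-preserving:
inside `{g_A < sphR}` it is the chart conjugate of `Θ`, on `{sphR' < g_A < hi}` it is `psi0`. [cite: MilnorHCobordism1965, Thm. 4.1] [cite: CerfDiffeoSphere1968, Ch. I §1, Lemme 2] -/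
theorem contMDiffAt_psi₁ (hA : Q.Adm M T δ ρ)
    (hΘs : ContMDiff 𝓘(ℝ, EuclideanSpace ℝ (Fin (n + 1))) 𝓘(ℝ, EuclideanSpace ℝ (Fin (n + 1))) ∞ Θ)
    (hΘn : ∀ v, ‖Θ v‖ = ‖v‖) {x : W} (hxm : gA x < C.A.hi) :
    ContMDiffAt (𝓡∂ (n + 1)) (𝓡∂ (n + 1)) ∞ (Q.psi₁ M T Θ δ ρ) x := by
  have hgc : Continuous gA := C.A.isMorseFunction.isMorse.contMDiff.continuous
  by_cases hx : gA x < C.A.sphR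
  · have hxs : gA x ≤ C.A.sph := (hx.trans C.A.sphR_lt_sph).le
    have hev : Q.psi₁ M T Θ δ ρ =ᶠ[𝓝 x] fun z => C.B.ofChart (Θ (C.A.toChart z)) := by
      filter_upwards [(isOpen_lt hgc continuous_const).mem_nhds hx] with z hz
      exact psi₁_of_lt hz
    refine ContMDiffAt.congr_of_eventuallyEq ?_ hev
    have hnorm : ‖Θ (C.A.toChart x)‖ < C.B.r₀ := by
      rw [hΘn, C.r₀_eq]
      exact lt_of_lt_of_le ((C.A.apply_lt_iff_norm_toChart_lt hxs C.A.rad_pos.le).1 hx) C.A.rad_lt_r₀.le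
    have h1 : ContMDiffAt (𝓡∂ (n + 1)) 𝓘(ℝ, EuclideanSpace ℝ (Fin (n + 1))) ∞ (Θ ∘ C.A.toChart) x :=
      hΘs.contMDiffAt.comp x (C.A.contMDiffAt_toChart (C.A.mem_source_of_apply_le hxs))
    have h2 : ContMDiffAt (𝓡∂ (n + 1)) (𝓡∂ (n + 1)) ∞ (C.B.ofChart ∘ (Θ ∘ C.A.toChart)) x :=
      (BasinSetting.contMDiffAt_ofChart hnorm).comp x h1
    exact h2
  · have hx' : C.A.sphR' < gA x := C.A.sphR'_lt_sphR.trans_le (not_lt.1 hx)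
    have hev : Q.psi₁ M T Θ δ ρ =ᶠ[𝓝 x] Q.psi0 M T δ ρ := by
      filter_upwards [(isOpen_lt continuous_const hgc).mem_nhds hx'] with z hz
      exact psi₁_eq_psi0_of_le hΘc hA hz.le
    refine ContMDiffAt.congr_of_eventuallyEq ?_ hev
    exact contMDiffAt_psi0 hA ⟨(apply_p₀_lt_sphR' C.A).trans hx', hxm⟩

end Cone

/-! ### The extension and the induced boundary map -/

variable (Q M) in
/-- **The extension** `Ψ = pull_B ∘ Ψ₁ ∘ push_A`. [cite: MilnorHCobordism1965, proof of Thm. 3.4, Thm. 4.1] -/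
def ext (T Θ : EuclideanSpace ℝ (Fin (n + 1)) → EuclideanSpace ℝ (Fin (n + 1))) (δ ρ : ℝ) (x : W) : W :=
  C.B.pull (Q.psi₁ M T Θ δ ρ (C.A.push x))

variable [Nonempty (BoundaryManifold.boundaryData n W).carrier]

variable (Q M) in
/-- **The induced boundary map** `bret_B ∘ Ψ₁ ∘ push_A` on `∂W`. [cite: MilnorHCobordism1965, Def. 3.9, Thm. 4.1] -/
def bdryMap (T Θ : EuclideanSpace ℝ (Fin (n + 1)) → EuclideanSpace ℝ (Fin (n + 1))) (δ ρ : ℝ)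
    (y : (𝓡∂ (n + 1)).boundary W) : (𝓡∂ (n + 1)).boundary W :=
  C.B.bret (Q.psi₁ M T Θ δ ρ (C.A.push (y : W)))

omit [Nonempty (BoundaryManifold.boundaryData n W).carrier] in
/-- Unfolding `ext`. [folklore] -/
theorem ext_def (x : W) : Q.ext M T Θ δ ρ x = C.B.pull (Q.psi₁ M T Θ δ ρ (C.A.push x)) := rfl

/-- Unfolding `bdryMap`. [folklore] -/
theorem bdryMap_def (y : (𝓡∂ (n + 1)).boundary W) :
    Q.bdryMap M T Θ δ ρ y = C.B.bret (Q.psi₁ M T Θ δ ρ (C.A.push (y : W))) := rfl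

section Levels

variable (hΘn : ∀ v, ‖Θ v‖ = ‖v‖)

omit [Nonempty (BoundaryManifold.boundaryData n W).carrier] in
include hΘn in
/-- The corrected map sends the level `L` of `A` to the level `L` of `B`. [folklore] -/
theorem apply_psi₁_push (hA : Q.Adm M T δ ρ) (x : W) (hx : gA (C.A.push x) = C.A.L) :
    gB (Q.psi₁ M T Θ δ ρ (C.A.push x)) = C.B.L := by
  rw [apply_psi₁ hΘn hA (by rw [hx]; exact C.A.L_lt_hi), hx, M.lam_L, C.L_eq]

omit [Nonempty (BoundaryManifold.boundaryData n W).carrier] in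
include hΘn in
/-- The corrected map sends `{g_A ≤ L}` into `{g_B ≤ L}`. [folklore] -/
theorem apply_psi₁_le (hA : Q.Adm M T δ ρ) {w : W} (hw : gA w ≤ C.A.L) : gB (Q.psi₁ M T Θ δ ρ w) ≤ C.B.L := by
  rw [apply_psi₁ hΘn hA (hw.trans_lt C.A.L_lt_hi)]; exact M.lam_le_L_iff.2 hw

include hΘn in
/-- **The extension restricts to the induced boundary map**: `ext (incl y) = incl (bdryMap y)`. [cite: MilnorHCobordism1965, Def. 3.9] -/
theorem ext_coe (hA : Q.Adm M T δ ρ) (y : (𝓡∂ (n + 1)).boundary W) :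
    Q.ext M T Θ δ ρ (y : W) = (Q.bdryMap M T Θ δ ρ y : W) := by
  set w := Q.psi₁ M T Θ δ ρ (C.A.push (y : W)) with hw
  have hwL : gB w = C.B.L := apply_psi₁_push hΘn hA _ (C.A.apply_push_coe y)
  rw [ext_def, bdryMap_def, ← hw, C.B.coe_bret (by rw [hwL]; exact C.B.one_sub_a'_lt_L.le)]
  conv_lhs => rw [← C.B.push_ret_of_apply_eq_L hwL]
  exact C.B.pull_push _

omit [Nonempty (BoundaryManifold.boundaryData n W).carrier] in
include hΘn in
/-- **The extension of inverse data inverts the extension.** [folklore] -/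
theorem ext_ext (hA : Q.Adm M T δ ρ) (hA' : Q.swap.Adm M.swap T' δ ρ) (hT'T : ∀ v, ‖v‖ = C.A.rad → T' (T v) = v)
    (hΘ : LeftInverse Θ' Θ) (x : W) : Q.swap.ext M.swap T' Θ' δ ρ (Q.ext M T Θ δ ρ x) = x := by
  have hle : gA (C.A.push x) ≤ C.A.L := C.A.apply_push_le x
  have hlt : gA (C.A.push x) < C.A.hi := hle.trans_lt C.A.L_lt_hi
  rw [ext_def, ext_def, swap_A, swap_B, C.B.push_pull (apply_psi₁_le hΘn hA hle), psi₁_psi₁ hΘn hA hA' hT'T hΘ hlt,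
    C.A.pull_push]

include hΘn in
/-- **The induced boundary map of inverse data inverts the induced boundary map.** [folklore] -/
theorem bdryMap_bdryMap (hA : Q.Adm M T δ ρ) (hA' : Q.swap.Adm M.swap T' δ ρ) (hT'T : ∀ v, ‖v‖ = C.A.rad → T' (T v) = v)
    (hΘ : LeftInverse Θ' Θ) (y : (𝓡∂ (n + 1)).boundary W) :
    Q.swap.bdryMap M.swap T' Θ' δ ρ (Q.bdryMap M T Θ δ ρ y) = y := by
  set w := Q.psi₁ M T Θ δ ρ (C.A.push (y : W)) with hw
  have hwL : gB w = C.B.L := apply_psi₁_push hΘn hA _ (C.A.apply_push_coe y)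
  have h1 : C.B.push (Q.bdryMap M T Θ δ ρ y : W) = w := by
    rw [bdryMap_def, ← hw, C.B.coe_bret (by rw [hwL]; exact C.B.one_sub_a'_lt_L.le), C.B.push_ret_of_apply_eq_L hwL]
  rw [bdryMap_def, swap_A, swap_B, h1, hw,
    psi₁_psi₁ hΘn hA hA' hT'T hΘ ((C.A.apply_push_le _).trans_lt C.A.L_lt_hi), C.A.bret_push_coe]

end Levels

section Smooth

variable (hΘc : ∀ v : EuclideanSpace ℝ (Fin (n + 1)), C.A.rad / 2 ≤ ‖v‖ → ‖v‖ ≤ C.A.rad →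
    Θ v = (‖v‖ / C.A.rad) • T ((C.A.rad / ‖v‖) • v))

omit [Nonempty (BoundaryManifold.boundaryData n W).carrier] in
include hΘc in
/-- **The extension is smooth.** [cite: MilnorHCobordism1965, proof of Thm. 3.4, Thm. 4.1] -/
theorem contMDiff_ext (hA : Q.Adm M T δ ρ)
    (hΘs : ContMDiff 𝓘(ℝ, EuclideanSpace ℝ (Fin (n + 1))) 𝓘(ℝ, EuclideanSpace ℝ (Fin (n + 1))) ∞ Θ)
    (hΘn : ∀ v, ‖Θ v‖ = ‖v‖) : ContMDiff (𝓡∂ (n + 1)) (𝓡∂ (n + 1)) ∞ (Q.ext M T Θ δ ρ) := by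
  have h1 : ContMDiffOn (𝓡∂ (n + 1)) (𝓡∂ (n + 1)) ∞ (Q.psi₁ M T Θ δ ρ) {w | gA w ≤ C.A.L} := fun w hw =>
    (contMDiffAt_psi₁ hΘc hA hΘs hΘn (lt_of_le_of_lt hw C.A.L_lt_hi)).contMDiffWithinAt
  have h2 : MapsTo (Q.psi₁ M T Θ δ ρ) {w | gA w ≤ C.A.L} {w | gB w ≤ C.B.L} := fun w hw => apply_psi₁_le hΘn hA hw
  have h3 : ContMDiffOn (𝓡∂ (n + 1)) (𝓡∂ (n + 1)) ∞ (C.B.pull ∘ Q.psi₁ M T Θ δ ρ) {w | gA w ≤ C.A.L} :=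
    C.B.contMDiffOn_pull.comp h1 h2
  have h4 : ContMDiffOn (𝓡∂ (n + 1)) (𝓡∂ (n + 1)) ∞ ((C.B.pull ∘ Q.psi₁ M T Θ δ ρ) ∘ C.A.push) univ :=
    h3.comp C.A.contMDiff_push.contMDiffOn fun x _ => C.A.apply_push_le x
  exact contMDiffOn_univ.1 h4

include hΘc in
/-- **The induced boundary map is smooth.** [folklore] -/
theorem contMDiff_bdryMap (hA : Q.Adm M T δ ρ)
    (hΘs : ContMDiff 𝓘(ℝ, EuclideanSpace ℝ (Fin (n + 1))) 𝓘(ℝ, EuclideanSpace ℝ (Fin (n + 1))) ∞ Θ)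
    (hΘn : ∀ v, ‖Θ v‖ = ‖v‖) : ContMDiff (𝓡 n) (𝓡 n) ∞ (Q.bdryMap M T Θ δ ρ) := by
  intro y
  have h1 : ContMDiffAt (𝓡 n) (𝓡∂ (n + 1)) ∞ (fun y : (𝓡∂ (n + 1)).boundary W => C.A.push (y : W)) y :=
    C.A.contMDiff_push.contMDiffAt.comp y
      (BoundaryManifold.isSmoothEmbedding_subtype_val (n := n) (W := W)).contMDiff.contMDiffAt
  have hL : gA (C.A.push (y : W)) = C.A.L := C.A.apply_push_coe y
  have h2 : ContMDiffAt (𝓡∂ (n + 1)) (𝓡∂ (n + 1)) ∞ (Q.psi₁ M T Θ δ ρ) (C.A.push (y : W)) :=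
    contMDiffAt_psi₁ hΘc hA hΘs hΘn (by rw [hL]; exact C.A.L_lt_hi)
  have h3 : ContMDiffAt (𝓡∂ (n + 1)) (𝓡 n) ∞ C.B.bret (Q.psi₁ M T Θ δ ρ (C.A.push (y : W))) :=
    C.B.contMDiffAt_bret (C.B.depth_lt_of_apply_eq_L (apply_psi₁_push hΘn hA _ hL))
  exact h3.comp y (h2.comp y h1)

end Smooth

/-! ### The diffeomorphisms -/

variable (Q M) in
/-- **Data for the structure conjugacy**: admissible direction maps for the couple and its swap,
mutually inverse on the small sphere, and mutually inverse smooth norm-preserving cone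
corrections. [cite: MilnorHCobordism1965, Thm. 4.1] [cite: CerfDiffeoSphere1968, Ch. I §1, Lemme 2] -/
structure ConjData (T T' Θ Θ' : EuclideanSpace ℝ (Fin (n + 1)) → EuclideanSpace ℝ (Fin (n + 1))) (δ ρ : ℝ) : Prop where
  /-- admissibility -/
  adm : Q.Adm M T δ ρ
  /-- admissibility of the swapped data -/
  adm' : Q.swap.Adm M.swap T' δ ρ
  /-- `T' ∘ T = id` on the small sphere -/
  T'T : ∀ v, ‖v‖ = C.A.rad → T' (T v) = v
  /-- `T ∘ T' = id` on the small sphere -/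
  TT' : ∀ v, ‖v‖ = C.A.rad → T (T' v) = v
  /-- `Θ' ∘ Θ = id` -/
  Θ'Θ : LeftInverse Θ' Θ
  /-- `Θ ∘ Θ' = id` -/
  ΘΘ' : LeftInverse Θ Θ'
  /-- `Θ` is smooth -/
  smooth : ContMDiff 𝓘(ℝ, EuclideanSpace ℝ (Fin (n + 1))) 𝓘(ℝ, EuclideanSpace ℝ (Fin (n + 1))) ∞ Θ
  /-- `Θ'` is smooth -/
  smooth' : ContMDiff 𝓘(ℝ, EuclideanSpace ℝ (Fin (n + 1))) 𝓘(ℝ, EuclideanSpace ℝ (Fin (n + 1))) ∞ Θ'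
  /-- `Θ` preserves the norm -/
  norm : ∀ v, ‖Θ v‖ = ‖v‖
  /-- `Θ'` preserves the norm -/
  norm' : ∀ v, ‖Θ' v‖ = ‖v‖
  /-- `Θ` is the cone of `T` on the shell -/
  cone : ∀ v : EuclideanSpace ℝ (Fin (n + 1)), C.A.rad / 2 ≤ ‖v‖ → ‖v‖ ≤ C.A.rad →
    Θ v = (‖v‖ / C.A.rad) • T ((C.A.rad / ‖v‖) • v)
  /-- `Θ'` is the cone of `T'` on the shell -/
  cone' : ∀ v : EuclideanSpace ℝ (Fin (n + 1)), C.B.rad / 2 ≤ ‖v‖ → ‖v‖ ≤ C.B.rad →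
    Θ' v = (‖v‖ / C.B.rad) • T' ((C.B.rad / ‖v‖) • v)

variable (Q M) in
omit [Nonempty (BoundaryManifold.boundaryData n W).carrier] in
/-- **The extension as a self-diffeomorphism of `W`.** [cite: MilnorHCobordism1965, Thm. 4.1] -/
def extDiffeomorph (h : Q.ConjData M T T' Θ Θ' δ ρ) : W ≃ₘ⟮𝓡∂ (n + 1), 𝓡∂ (n + 1)⟯ W where
  toFun := Q.ext M T Θ δ ρ
  invFun := Q.swap.ext M.swap T' Θ' δ ρ
  left_inv := ext_ext h.norm h.adm h.adm' h.T'T h.Θ'Θ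
  right_inv := ext_ext (Q := Q.swap) (M := M.swap) h.norm' h.adm' h.adm (fun v hv => h.TT' v (by rw [← C.rad_eq]; exact hv)) h.ΘΘ'
  contMDiff_toFun := contMDiff_ext h.cone h.adm h.smooth h.norm
  contMDiff_invFun := contMDiff_ext h.cone' h.adm' h.smooth' h.norm'

variable (Q M) in
/-- **The induced boundary map as a self-diffeomorphism of `∂W`.** [folklore] -/
def bdryDiffeomorph (h : Q.ConjData M T T' Θ Θ' δ ρ) :
    (𝓡∂ (n + 1)).boundary W ≃ₘ⟮𝓡 n, 𝓡 n⟯ (𝓡∂ (n + 1)).boundary W where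
  toFun := Q.bdryMap M T Θ δ ρ
  invFun := Q.swap.bdryMap M.swap T' Θ' δ ρ
  left_inv := bdryMap_bdryMap h.norm h.adm h.adm' h.T'T h.Θ'Θ
  right_inv := bdryMap_bdryMap (Q := Q.swap) (M := M.swap) h.norm' h.adm' h.adm
    (fun v hv => h.TT' v (by rw [← C.rad_eq]; exact hv)) h.ΘΘ'
  contMDiff_toFun := contMDiff_bdryMap h.cone h.adm h.smooth h.norm
  contMDiff_invFun := contMDiff_bdryMap h.cone' h.adm' h.smooth' h.norm'

/-- The boundary diffeomorphism as a function. [folklore] -/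
theorem coe_bdryDiffeomorph (h : Q.ConjData M T T' Θ Θ' δ ρ) : ⇑(Q.bdryDiffeomorph M h) = Q.bdryMap M T Θ δ ρ := rfl

/-- **The induced boundary diffeomorphism extends over `W`** (by the extension diffeomorphism). [cite: MilnorHCobordism1965, Thm. 4.1] -/
theorem diffeoExtends_bdryDiffeomorph (h : Q.ConjData M T T' Θ Θ' δ ρ) :
    (BoundaryManifold.boundaryData n W).DiffeoExtends (Q.bdryDiffeomorph M h) :=
  ⟨Q.extDiffeomorph M h, funext fun y => ext_coe h.norm h.adm y⟩

end SaddleData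

end BasinCouple

end Literature.Topology.FourManifolds
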